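/-
Copyright (c) 2026 the pub-hodgecm2 formalisation cell (harness21).  New file, outside the frozen port manifest.
Origin: seat `prover-pub-hodgecm2-d2bridge-prove-2-g1-0` (Δ2 BRIDGE team; VERSION-B item (c) J-RECORD PIN with d2bridge-prove-5; part 0 of the S2 PIN
`Map43RecordAtPin`), 2026-08-23.  One structure + one definition + one theorem; no named fact, no `sorry`, no new axiom; HC_CM is NOT proved.
-/
import Summits.HodgeConjecture.HodgeCM.Model.TowerRes
import Summits.HodgeConjecture.HodgeCM.Model.TowerAlgebra
import Summits.HodgeConjecture.CorCM.B01.Transposition.HComp.HonestP5Of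
import Literature.NumberTheory.Automorphic.Liu2021.AppendixC.HeckeTranslates
import Literature.AlgebraicGeometry.Motives.AbelianVarietyBaseChange
import HarnessLib

set_option autoImplicit false

/-!
# Δ2 bridge, the J2 ⇄ J-record INTERFACE: «Albanese on components» (`ComponentAlbanese`)

Y. Liu, *Fourier–Jacobi cycles and arithmetic relative trace formula*, Camb. J. Math. **9** (2021) 1–147 = arXiv:2102.11518 [Liu2021];
TeX source `FJcycle.tex` (`l. NNNN` = its lines).

The ONE interface between the J2 pin (d2bridge-prove-5, `CorCM/D2Bridge/AlbaneseOnComponents.lean`: Liu's Albanese morphism `(α_{X_K})_x`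
restricted to the components `P_{Γ_K,h}` of `X_K ⊗_{E,ι₁} ℂ`, proof of Lem. 2.4 (1) l. 1220–1222) and the J-record pin (d2bridge-prove-2,
`CorCM/D2Bridge/Map43RecordAtPinLevels.lean` ∕ `Map43RecordAtPin.lean`: the proof-objects record `Map43RationalData` of the map (4.2)/(4.3), proof of
Thm. 4.18 l. 2247–2253, at the model's tower).  A STRUCTURE `ComponentAlbanese hHD hI hU h₃ hA V h Φ C T` whose fields are EXACTLY the J2 pin's
deliverables — the level dictionary `Γof` (+ three order laws), the component Albanese morphisms `alb K h : P_{Γ_K,h} ⟶ A_K ⊗ ℂ`, and their laws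
ON `H¹(−; ℚ)`: (ii) coherence along the tower relation `Rel`, (iii) the level-transition square with `C.Atr f`, (iv) the Hecke square with
`T.albTr g`, (v′) hom-level detection — plus `transport` along an equality of §4.2 data and the corollary `eq_zero_of_pull_alb_comp_eq_zero`.
This file imports NEITHER pin (only the model's tower files and the §4.2 vocabulary), so each side files against it independently.
Nothing is asserted; HC_CM is NOT proved; «Δ2 BRIDGE CLOSED» is NOT claimed.

## References
* [Liu2021] §2.1 Def. 2.3, Lem. 2.4 (1) with proof (l. 1202–1228); §4.2 l. 2062–2074.
* Tree: `HodgeCM/Model/TowerLevel_1 ∕ LevelTranslate ∕ LevelConjugate ∕ Universe`, `Liu2021/AppendixC/Glue ∕ HeckeTranslates`,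
  `CorCM/B01/Transposition/HComp/HonestP5Of`, `CorCM/D2Bridge/AlbaneseOnPiece{Core,Functorial}` (the J2 core these laws come from).
-/

noncomputable section

open scoped TensorProduct
open CategoryTheory NumberField Function
open Literature.AlgebraicGeometry.Motives (AbelianVariety bettiCohomology)
open Literature.AlgebraicGeometry.HodgeTheory
open Literature.AlgebraicGeometry.ShimuraVarieties.UnitaryCanonicalModel (exists_recordSystem)
open Literature.NumberTheory.Automorphic Literature.NumberTheory.Automorphic.Liu2021 Literature.NumberTheory.Automorphic.Liu2021.AppendixC
open Literature.NumberTheory.Automorphic.PicardCM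
open Literature.NumberTheory.Transcendental (Arapura2012_Cor_15_4_6)
open HodgeCM.Model.LevelTranslate HodgeCM.Model.TowerLevel HodgeCM.Model.TowerCarrier

namespace Summit.HodgeConjecture.CorCM.D2Bridge

variable (hHD : exists_isReal_hodgeModel) (hI : hodgePQ_independent_of_hodgeModel)
  (hU : BallQuotientUniformisedDatum) (h₃ : CMAbelianVarietyRealised) (hA : Arapura2012_Cor_15_4_6)
variable {L : HodgeCM.CMField} {ι₁ : L →+* ℂ}

variable (V : HodgeCM.HermSpace3 L ι₁) (h : exists_recordSystem) (Φ : Literature.AlgebraicGeometry.Motives.CMType L)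
  {isotropicAt : ℕ → Prop}
  (C : Sec42Data (Model.honestP5Of h ⟨L.K⟩ ι₁ ⟨V.Hm, V.isHermitian, V.signature_ι₁, V.posDef_of_ne⟩ Φ) isotropicAt)
  (T : C.HeckeTranslates) [Algebra L ℂ]

/-! ## §1  The J2 interface: Albanese on components -/

/-- **The J2 pin «ALBANESE ON COMPONENTS», as an interface** ([Liu2021] proof of Lem. 2.4 (1), l. 1220–1222: «pick `x ∈ X(π₀(X ⊗_{k,τ} ℂ))`,
which induces `(α_X)_x : X ⊗ ℂ → Alb_X ⊗ ℂ`», restricted to the pieces; §4.2 l. 2062–2074).  For the §4.2 datum `C` (levels `K ⊆ K₀`,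
`X_K`, `A_K = Alb_{X_K}`, transitions `Atr`, Hecke translates `T.albTr`) and the model's tower over `(L, ι₁, V)` (components
`P_{Γ,h} = U.pms L ι₁ V (Γ.conj h)`): a level dictionary `Γof` (monotone, compatible with conjugation), for every `K` and index `h` a
`ℂ`-morphism `alb K h : P_{Γ_K,h} ⟶ A_K ⊗_{E,ι₁} ℂ` (at the pin `albOnPiece (C.alb K) inj_h y_h`), and its laws ON `H¹(−; ℚ)`: (ii) coherence
along the tower relation `Rel`, (iii) the level-transition square with `C.Atr f`, (iv) the Hecke square with `T.albTr g`, (v′) HOM-LEVEL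
DETECTION of `E`-homomorphisms out of `A_K`.  Nothing is asserted: every field is a theorem of the J2 pin file.
[cite: Liu2021, proof of Lemma 2.4 (1) (FJcycle.tex l. 1220–1228); §4.2 l. 2062–2074] -/
structure ComponentAlbanese where
  /-- ⟨pin⟩ the model's level of a sufficiently small open compact `K ⊆ K₀` (at the pin: `K` itself, paired with `U(L⁺) ∩ K`). -/
  Γof : C5.SmallLevel C.S.K₀ → HodgeCM.Level V
  /-- ⟨pin⟩ every such level is below a conjugate of `K_f(3)`. -/
  belowConjThree : ∀ K, (Γof K).BelowConjThree
  /-- ⟨pin⟩ the dictionary is monotone. -/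
  Γof_mono : ∀ {K K' : C5.SmallLevel C.S.K₀}, K' ≤ K → Γof K' ≤ Γof K
  /-- ⟨pin⟩ the dictionary is compatible with the Hecke condition `g⁻¹ K₁ g ⊆ K` (i.e. `K₁ ⊆ g K g⁻¹`). -/
  Γof_hecke : ∀ (g : ↥V.adelicFin) {K₁ K : C5.SmallLevel C.S.K₀}, C5.HeckeLE g K₁ K → Γof K₁ ≤ (Γof K).conj g (belowConjThree K)
  /-- ⟨pin⟩ `(α_{X_K})_x|_{P_{Γ_K,h}} : P_{Γ_K,h} ⟶ A_K ⊗_{E,ι₁} ℂ`, the Albanese morphism on the component of index `h`. -/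
  alb : ∀ (K : C5.SmallLevel C.S.K₀) (g : ↥V.adelicFin),
    Var.scheme hU h₃ (.pms (HodgeCM.Model.pmsCode L ι₁ V ((Γof K).conj g (belowConjThree K)))) ⟶ ((C.A K).baseChange ℂ).X
  /-- ⟨pin law (ii)⟩ coherence on `H¹` along the tower relation: `(alb K h)^* = t_γ^* ∘ (alb K h')^*` for `h' ∈ (γ)_f h K`. -/
  pull_alb_rel : ∀ (K : C5.SmallLevel C.S.K₀) (γ : ↥(Urat V)) (g g' : ↥V.adelicFin) (r : Rel (Γof K) γ g g'),
    BettiUniverse.pull (alb K g) 1 =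
      (HodgeCM.Model.universeOf hHD hI hU h₃).pull (transMorU hU h₃ hHD hI hA γ.2 ((Γof K).conj g (belowConjThree K))
          ((Γof K).conj g' (belowConjThree K)) (transCond_of_rel (belowConjThree K) r)) 1 ∘ₗ BettiUniverse.pull (alb K g') 1
  /-- ⟨pin law (iii)⟩ the level-transition square on `H¹`: `(alb K' h)^* ∘ (Alb_{u^{K'}_K})_ℂ^* = t_1^* ∘ (alb K h)^*`. -/
  pull_alb_Atr : ∀ {K K' : C5.SmallLevel C.S.K₀} (f : K' ⟶ K) (g : ↥V.adelicFin),
    BettiUniverse.pull (alb K' g) 1 ∘ₗ BettiUniverse.pull (AbelianVariety.Hom.baseChange ℂ (C.Atr f)).hom.hom.hom 1 =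
      (HodgeCM.Model.universeOf hHD hI hU h₃).pull (transMorU hU h₃ hHD hI hA (1 : ↥(Urat V)).2 ((Γof K').conj g (belowConjThree K'))
          ((Γof K).conj g (belowConjThree K)) (transCond_conj_of_le (Γof_mono f.le) (belowConjThree K) (belowConjThree K') g)) 1 ∘ₗ BettiUniverse.pull (alb K g) 1
  /-- ⟨pin law (iv)⟩ the Hecke square on `H¹`: `(alb K₁ h)^* ∘ (Alb(T_g))_ℂ^* = t_1^* ∘ (alb K (h g))^*` for `g⁻¹ K₁ g ⊆ K`. -/
  pull_alb_albTr : ∀ (g : ↥V.adelicFin) {K₁ K : C5.SmallLevel C.S.K₀} (hK : C5.HeckeLE g K₁ K) (g' : ↥V.adelicFin),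
    BettiUniverse.pull (alb K₁ g') 1 ∘ₗ BettiUniverse.pull (AbelianVariety.Hom.baseChange ℂ (T.albTr g K₁ K hK)).hom.hom.hom 1 =
      (HodgeCM.Model.universeOf hHD hI hU h₃).pull (transMorU hU h₃ hHD hI hA (1 : ↥(Urat V)).2 ((Γof K₁).conj g' (belowConjThree K₁))
          ((Γof K).conj (g' * g) (belowConjThree K))
          ((transCond_conj_of_le (Γof_hecke g hK) ((belowConjThree K).conj g) (belowConjThree K₁) g').one_trans
            (transCond_conj_conj (belowConjThree K) g g'))) 1 ∘ₗ BettiUniverse.pull (alb K (g' * g)) 1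
  /-- ⟨pin law (v′)⟩ hom-level detection: the `(alb K h)^*` jointly see (the complexification of) every non-zero homomorphism
  `φ : A_K → B` over `E` (prove-3's `exists_pull_albOnPiece_baseChange_ne_zero'` at the representatives). -/
  alb_detect : ∀ (K : C5.SmallLevel C.S.K₀) {B : AbelianVariety L} (φ : C.A K ⟶ B), φ ≠ 0 →
    ∃ g : ↥V.adelicFin, BettiUniverse.pull (alb K g ≫ (AbelianVariety.Hom.baseChange ℂ φ).hom.hom.hom) 1 ≠ 0

variable {hHD hI hU h₃ hA V h Φ C T}
variable (J : ComponentAlbanese hHD hI hU h₃ hA V h Φ C T)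

namespace ComponentAlbanese

/-- **Transport of the interface along an equality of §4.2 data** (for the glue `sec42DataOfFourLe … = sec42DataOf …`,
`sec42DataOf_eq_of_four_le`, whose Hecke translates `sec42DataOf_heckeTranslates` are DEFINED as the corresponding `cast`). [folklore] -/
def transport {C' : Sec42Data (Model.honestP5Of h ⟨L.K⟩ ι₁ ⟨V.Hm, V.isHermitian, V.signature_ι₁, V.posDef_of_ne⟩ Φ) isotropicAt}
    (e : C = C') : ComponentAlbanese hHD hI hU h₃ hA V h Φ C' (cast (congrArg (fun C₀ => Sec42Data.HeckeTranslates C₀) e) T) := by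
  subst e; exact J

/-- **LAW (v′) read on a homomorphism**: if `(alb K h ≫ φ_ℂ)^* = 0` on `H¹` for every index `h`, then `φ = 0`.
[cite: Liu2021, proof of Lemma 2.4 (1) (FJcycle.tex l. 1220–1228)] -/
theorem eq_zero_of_pull_alb_comp_eq_zero (K : C5.SmallLevel C.S.K₀) {B : AbelianVariety L} (φ : C.A K ⟶ B)
    (hφ : ∀ g : ↥V.adelicFin, BettiUniverse.pull (J.alb K g ≫ (AbelianVariety.Hom.baseChange ℂ φ).hom.hom.hom) 1 = 0) :
    φ = 0 := by
  by_contra hne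
  obtain ⟨g, hg⟩ := J.alb_detect K φ hne
  exact hg (hφ g)

end ComponentAlbanese

end Summit.HodgeConjecture.CorCM.D2Bridge

end
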